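import Summits.HodgeConjecture.CorCM.Census.OcticWeilFourfoldParts
import Mathlib.LinearAlgebra.Matrix.Notation
import HarnessLib

/-!
# The GALOIS ORBIT of a simple CM fourfold of Weil type: `E × B₁ × B₂ × B₃` for the three pairwise non-conjugate
# `(2,2)`-types `Φ_{I_m}`, `I_m = {0, m}` of ONE octic CM field `F ⊇ k` with `2`-transitive (`A₄`/`S₄`) quartic part —
# the balanced weights of every product of copies are conjugate pairs and Weil `4`-sets of the `B_m` (kernel census)

COR-CM (cell `pub-hodgecm2`), seat b30 gen 19 (2026-08-21); count-neutral own lane OCTIC-WEIL22, part ORBIT (the NEXT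
SIZED ITEM of `Census/OcticWeilFourfold`: several Galois-conjugate degenerate fourfolds at once).  Bookkeeping definitions
and theorems of a finite model; no named fact, no geometry, no `sorry`.

SETTING (to be formalised downstream).  `F ⊇ i(k)` octic CM, `τ : k → ℂ`, a frame `e : Hom(F, ℂ) ≃ Fin 4 × Bool` as in
`Census/OcticWeilFourfold`, and the SIX CM types of `k`-signature `(2,2)`: `Φ_J = e⁻¹({(a,true) | a ∈ J} ⊔ {(a,false) |
a ∉ J})`, `J` a `2`-subset of the four conjugate pairs — ONE `Aut(ℂ)`-orbit when the quartic part is `A₄`/`S₄` (Dodson: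
the Galois conjugates `σB` of a DEGENERATE SIMPLE CM fourfold `B`).  Since `Φ_{Jᶜ} = Φ̄_J` is realised by the same
abelian varieties (conjugate structure), three types suffice: `I_m = {0, m+1}`, `m < 3`.  THE GALOIS INPUT: every EVEN
permutation `π` of the four pairs is induced by an automorphism of `ℂ` fixing `τ` (Dodson 1984 §3.3.2: the image of
`Gal(Fᶜ/k)` in `Sym` of the block is `A₄` or `S₄`).

MODEL.  `Pt₃ = Bool ⊕ (Fin 3 × (Fin 4 × Bool))`: `inl c` = the embedding of `k` of sign `c`; `inr (m, (a, c))` = the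
embedding of `F` of sign `c` in the pair `a`, read on a factor of TYPE `m`.  For the even permutation number `r < 12`
(`permTab r`), `ρ_r⁻¹(type) = phiTab r = {inl true} ⊔ {inr (m, (a, c)) | c = [permTab r a ∈ I_m]}` (`signTab r m a`).
A configuration `(T, v)` is balanced iff `2 · #{x ∈ T | v x ∈ phiTab r} = |T|` for the twelve `r` (`ModelBalanced₃`).

RESULTS (kernel).
* `balanced₃_iff_signed` — the twelve equations in signed form `e + Σ_{m,a} ± d_{m,a} = 0` (`e = N(inl true) − N(inl false)`,
  `d_{m,a} = N(m,a,true) − N(m,a,false)`);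
* **`defect₃_of_signed` / `exists_defect₃_of_modelBalanced₃`** — THE DEFECT LAW: `e = 0` and `d_{m,a} = d_{m,0}` for all
  `m, a` (rank `10` of the twelve equations in the `13` unknowns; exact python `work/scratch/orbit_defect.py`): the Hodge
  lattice of the slice `{E, B₁, B₂, B₃}` is `⟨13 conjugate pairs⟩ ⊕ ℤ w₁ ⊕ ℤ w₂ ⊕ ℤ w₃`, `w_m = Σ_a [(m, a, τ)]` the Weil
  weight of `B_m` — NO class mixes two conjugates, and the curve enters through divisors only;
* parts: pair parts and Weil parts `IsWeil₃Part v m b G` (one point over each `(m, a, b)`, `a < 4`); extraction and the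
  induction principle `modelBalanced₃_induction`.
[cite: Pohlmann1968, Thm 1] [cite: GaoUllmo2025, Thm 3.1] [cite: Dodson1984, §3.3.2 Theorem] [cite: MoonenZarhin1995Duke, Thm. 2.4]

## References
* [Pohlmann1968] H. Pohlmann, Ann. of Math. 88 (1968), Thm 1.  [GaoUllmo2025] Z. Gao, E. Ullmo, J. Inst. Math. Jussieu 25
  (2025), Thm 3.1.  [Dodson1984] B. Dodson, Trans. AMS 283 (1984), §3.3.2.  [MoonenZarhin1995Duke] Duke Math. J. 77 (1995),
  Thm. 2.4.  [Gordon1999HodgeAVSurvey] B. B. Gordon, CRM Monogr. 10 (1999), 5.13 (ii).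

## Provenance
Exact python (`work/scratch/kslice_census.py`, `orbit_defect.py`): balanced lattice of `E + B₀₁ + B₀₂ + B₀₃` has rank `16` =
rank of ⟨pairs, w₁, w₂, w₃⟩ under both `A₄` and `S₄` (deficiency `0`); with a type AND its complement the deficiency is `3`
(graph classes of `B̄ ∼ B`); the four `(1,3)`-conjugates `E + B'₀..B'₃` have deficiency `3` (open atoms).
-/

namespace Summit.HodgeConjecture.CorCM.Census.OcticWeilOrbit

open Finset

/-! ### The model -/

/-- Points: `inl c` = embedding of `k` of sign `c`; `inr (m, (a, c))` = embedding of `F` of sign `c` in the pair `a` on a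
factor of type `m`. [cite: GaoUllmo2025, §2.1] -/
abbrev Pt₃ : Type := Bool ⊕ (Fin 3 × (Fin 4 × Bool))

/-- Complex conjugation on the model: the sign flips. [folklore] -/
def cj₃ : Pt₃ → Pt₃
  | Sum.inl c => Sum.inl (!c)
  | Sum.inr (m, (a, c)) => Sum.inr (m, (a, !c))

/-- Unfolding of `cj₃`, curve slot. [folklore] -/
theorem cj₃_inl (c : Bool) : cj₃ (Sum.inl c) = Sum.inl (!c) := rfl

/-- Unfolding of `cj₃`, fourfold slots. [folklore] -/
theorem cj₃_inr (m : Fin 3) (a : Fin 4) (c : Bool) : cj₃ (Sum.inr (m, (a, c))) = Sum.inr (m, (a, !c)) := rfl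

/-- `cj₃` is a fixed-point-free involution. [folklore] -/
theorem cj₃_facts : (∀ y : Pt₃, cj₃ (cj₃ y) = y) ∧ ∀ y : Pt₃, cj₃ y ≠ y := by
  refine ⟨by decide +kernel, by decide +kernel⟩

/-- The twelve EVEN permutations of the four conjugate pairs (the alternating group `A₄`, as a table). [folklore] -/
def permTab : Fin 12 → Fin 4 → Fin 4 :=
  ![![0, 1, 2, 3], ![0, 2, 3, 1], ![0, 3, 1, 2], ![1, 0, 3, 2], ![1, 2, 0, 3], ![1, 3, 2, 0], ![2, 0, 1, 3], ![2, 1, 3, 0], ![2, 3, 0, 1], ![3, 0, 2, 1], ![3, 1, 0, 2], ![3, 2, 1, 0]]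

/-- `signTab r m a = [permTab r a ∈ I_m]`, `I_m = {0, m+1}`: whether the label `(a, true)` of a factor of type `m` lies in
`ρ_r⁻¹Φ_{I_m}`. [folklore] -/
def signTab : Fin 12 → Fin 3 → Fin 4 → Bool :=
  ![
    ![![true, true, false, false], ![true, false, true, false], ![true, false, false, true]],
    ![![true, false, false, true], ![true, true, false, false], ![true, false, true, false]],
    ![![true, false, true, false], ![true, false, false, true], ![true, true, false, false]],
    ![![true, true, false, false], ![false, true, false, true], ![false, true, true, false]],
    ![![true, false, true, false], ![false, true, true, false], ![false, false, true, true]],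
    ![![true, false, false, true], ![false, false, true, true], ![false, true, false, true]],
    ![![false, true, true, false], ![true, true, false, false], ![false, true, false, true]],
    ![![false, true, false, true], ![true, false, false, true], ![false, false, true, true]],
    ![![false, false, true, true], ![true, false, true, false], ![false, true, true, false]],
    ![![false, true, false, true], ![false, true, true, false], ![true, true, false, false]],
    ![![false, true, true, false], ![false, false, true, true], ![true, false, true, false]],
    ![![false, false, true, true], ![false, true, false, true], ![true, false, false, true]]]

/-- The table `signTab` is `[permTab r a ∈ {0, m+1}]`. [folklore] -/
theorem signTab_eq : ∀ (r : Fin 12) (m : Fin 3) (a : Fin 4),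
    signTab r m a = decide (permTab r a = 0 ∨ permTab r a = m.succ) := by decide +kernel

/-- `permTab` lists bijections, pairwise distinct, containing the identity (row `0`). [folklore] -/
theorem permTab_facts : (∀ r : Fin 12, Function.Injective (permTab r)) ∧ (∀ r r' : Fin 12, permTab r = permTab r' → r = r') ∧
    permTab 0 = id := by
  refine ⟨by decide +kernel, by decide +kernel, by decide +kernel⟩

/-- **`ρ_r⁻¹(type)` read in the model** (Boolean form): `τ` on the curve, and on a factor of type `m` the labels `(a, c)`
with `c = [permTab r a ∈ I_m]`. [cite: GaoUllmo2025, Thm 3.1 (3.2)] -/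
def inPhiTab (r : Fin 12) : Pt₃ → Bool
  | Sum.inl c => c
  | Sum.inr (m, (a, c)) => c == signTab r m a

/-- `ρ_r⁻¹(type)` as a finset of the model. [cite: GaoUllmo2025, Thm 3.1 (3.2)] -/
def phiTab (r : Fin 12) : Finset Pt₃ := univ.filter fun y => inPhiTab r y = true

/-- Membership, curve slot. [folklore] -/
theorem inl_mem_phiTab (r : Fin 12) (c : Bool) : Sum.inl c ∈ phiTab r ↔ c = true := by
  simp [phiTab, inPhiTab]

/-- Membership, fourfold slots. [folklore] -/
theorem inr_mem_phiTab (r : Fin 12) (m : Fin 3) (a : Fin 4) (c : Bool) :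
    Sum.inr (m, (a, c)) ∈ phiTab r ↔ c = signTab r m a := by
  simp [phiTab, inPhiTab]

/-- Each `phiTab r` is a CM type of the model (exactly one of `y`, `cj₃ y`; thirteen points). [folklore] -/
theorem phiTab_isCMType : ∀ r : Fin 12, (∀ y : Pt₃, (y ∈ phiTab r ↔ cj₃ y ∉ phiTab r)) ∧ (phiTab r).card = 13 := by
  decide +kernel

/-- `phiTab r` as an explicit finset: `{inl true} ⊔ {inr (m, (a, signTab r m a))}`. [folklore] -/
theorem phiTab_eq (r : Fin 12) : phiTab r =
    insert (Sum.inl true) ((univ : Finset (Fin 3 × Fin 4)).image fun q => (Sum.inr (q.1, (q.2, signTab r q.1 q.2)) : Pt₃)) := by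
  revert r; decide +kernel

/-! ### Balanced configurations -/

variable {α : Type*}

/-- **Pohlmann's condition for a configuration** of a product of copies of `E, B₁, B₂, B₃` under `A₄`-realisation: the
twelve equations `2 · #{x ∈ T | v x ∈ ρ_r⁻¹(type)} = |T|`. [cite: GaoUllmo2025, Thm 3.1 eq. (3.2)] [cite: Dodson1984, §3.3.2 Theorem] -/
def ModelBalanced₃ (v : α → Pt₃) (T : Finset α) : Prop :=
  ∀ r : Fin 12, 2 * (T.filter fun x => v x ∈ phiTab r).card = T.card

variable (v : α → Pt₃)

/-- The empty configuration is balanced. [folklore] -/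
theorem modelBalanced₃_empty : ModelBalanced₃ v (∅ : Finset α) := fun _ => by simp

variable {v}

/-- **Removing a balanced part keeps the balance.** [folklore] -/
theorem ModelBalanced₃.sdiff [DecidableEq α] {T G : Finset α} (hT : ModelBalanced₃ v T) (hG : ModelBalanced₃ v G)
    (hGT : G ⊆ T) : ModelBalanced₃ v (T \ G) := by
  intro r
  have key : ∀ (Q : α → Prop) [DecidablePred Q],
      ((T \ G).filter Q).card = (T.filter Q).card - (G.filter Q).card := by
    intro Q _
    rw [← Finset.card_sdiff_of_subset (Finset.filter_subset_filter Q hGT)]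
    congr 1
    ext x
    simp only [Finset.mem_filter, Finset.mem_sdiff]
    tauto
  have h1 := hT r
  have h2 := hG r
  have h3 := Finset.card_sdiff_of_subset hGT
  have h4 : (G.filter fun x => v x ∈ phiTab r).card ≤ (T.filter fun x => v x ∈ phiTab r).card :=
    Finset.card_le_card (Finset.filter_subset_filter _ hGT)
  rw [key, h3]
  omega

/-! ### Counting fibrewise; the signed form -/

variable (v)

/-- `#{x ∈ T | v x ∈ W} = Σ_{y ∈ W} #{x ∈ T | v x = y}`. [folklore] -/
theorem card_filter_mem_eq_sum₃ (T : Finset α) (W : Finset Pt₃) :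
    (T.filter fun x => v x ∈ W).card = ∑ y ∈ W, (T.filter fun x => v x = y).card := by
  rw [Finset.card_eq_sum_card_fiberwise (f := v) (s := T.filter fun x => v x ∈ W) (t := W)
    (fun x hx => (Finset.mem_filter.1 (Finset.mem_coe.1 hx)).2)]
  refine Finset.sum_congr rfl fun y hy => ?_
  congr 1
  ext x
  simp only [Finset.mem_filter]
  constructor
  · rintro ⟨⟨hx, -⟩, hxy⟩; exact ⟨hx, hxy⟩
  · rintro ⟨hx, hxy⟩; exact ⟨⟨hx, hxy ▸ hy⟩, hxy⟩

/-- `|T| = Σ_y #{x ∈ T | v x = y}`. [folklore] -/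
theorem card_eq_sum₃ (T : Finset α) : T.card = ∑ y : Pt₃, (T.filter fun x => v x = y).card := by
  rw [← card_filter_mem_eq_sum₃ v T univ]
  congr 1
  ext x
  simp

/-- A sum over the model, expanded by slots. [folklore] -/
theorem sum_pt₃ (N : Pt₃ → ℕ) : ∑ y : Pt₃, N y =
    N (Sum.inl true) + N (Sum.inl false) + ∑ m : Fin 3, ∑ a : Fin 4, (N (Sum.inr (m, (a, true))) + N (Sum.inr (m, (a, false)))) := by
  rw [Fintype.sum_sum_type, Fintype.sum_bool, Fintype.sum_prod_type]
  simp only [Fintype.sum_prod_type, Fintype.sum_bool]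

/-- The sum over `phiTab r`, expanded. [folklore] -/
theorem sum_phiTab (r : Fin 12) (N : Pt₃ → ℕ) :
    ∑ y ∈ phiTab r, N y = N (Sum.inl true) + ∑ m : Fin 3, ∑ a : Fin 4, N (Sum.inr (m, (a, signTab r m a))) := by
  rw [phiTab_eq r]
  have hinj : Function.Injective fun q : Fin 3 × Fin 4 => (Sum.inr (q.1, (q.2, signTab r q.1 q.2)) : Pt₃) := by
    rintro ⟨m, a⟩ ⟨m', a'⟩ h
    simp only [Sum.inr.injEq, Prod.mk.injEq] at h
    obtain ⟨rfl, rfl, -⟩ := h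
    rfl
  have h1 : Sum.inl true ∉ (univ : Finset (Fin 3 × Fin 4)).image
      fun q => (Sum.inr (q.1, (q.2, signTab r q.1 q.2)) : Pt₃) := by simp
  rw [Finset.sum_insert h1, Finset.sum_image fun q _ q' _ h => hinj h, Fintype.sum_prod_type]

/-- **The signed form of the `r`-th balance equation**: `2 Σ_{y ∈ phiTab r} N y = Σ_y N y` iff
`(N t − N f) + Σ_{m,a} ± (N(m,a,t) − N(m,a,f)) = 0`, the sign being `+` iff `signTab r m a`. [cite: GaoUllmo2025, Thm 3.1] -/
theorem balanced₃_iff_signed (r : Fin 12) (N : Pt₃ → ℕ) :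
    2 * ∑ y ∈ phiTab r, N y = ∑ y : Pt₃, N y ↔
      ((N (Sum.inl true) : ℤ) - N (Sum.inl false)) + ∑ m : Fin 3, ∑ a : Fin 4,
        (if signTab r m a then ((N (Sum.inr (m, (a, true))) : ℤ) - N (Sum.inr (m, (a, false))))
          else -(((N (Sum.inr (m, (a, true))) : ℤ) - N (Sum.inr (m, (a, false)))))) = 0 := by
  rw [sum_phiTab, sum_pt₃]
  have key : ∀ m a, (2 * (N (Sum.inr (m, (a, signTab r m a))) : ℤ)) =
      ((N (Sum.inr (m, (a, true))) : ℤ) + N (Sum.inr (m, (a, false)))) +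
        (if signTab r m a then ((N (Sum.inr (m, (a, true))) : ℤ) - N (Sum.inr (m, (a, false))))
          else -(((N (Sum.inr (m, (a, true))) : ℤ) - N (Sum.inr (m, (a, false)))))) := by
    intro m a
    cases signTab r m a <;> simp <;> ring
  have hsum : (2 * (∑ m : Fin 3, ∑ a : Fin 4, N (Sum.inr (m, (a, signTab r m a)))) : ℤ) =
      (∑ m : Fin 3, ∑ a : Fin 4, (((N (Sum.inr (m, (a, true))) : ℤ) + N (Sum.inr (m, (a, false)))))) +
        ∑ m : Fin 3, ∑ a : Fin 4,
          (if signTab r m a then ((N (Sum.inr (m, (a, true))) : ℤ) - N (Sum.inr (m, (a, false))))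
            else -(((N (Sum.inr (m, (a, true))) : ℤ) - N (Sum.inr (m, (a, false)))))) := by
    push_cast
    rw [Finset.mul_sum, ← Finset.sum_add_distrib]
    refine Finset.sum_congr rfl fun m _ => ?_
    rw [Finset.mul_sum, ← Finset.sum_add_distrib]
    refine Finset.sum_congr rfl fun a _ => ?_
    exact key m a
  constructor
  · intro h
    have hz : (2 : ℤ) * ((N (Sum.inl true) : ℤ) + ((∑ m : Fin 3, ∑ a : Fin 4, N (Sum.inr (m, (a, signTab r m a))) : ℕ) : ℤ)) =
        (N (Sum.inl true) : ℤ) + N (Sum.inl false) +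
          ((∑ m : Fin 3, ∑ a : Fin 4, (N (Sum.inr (m, (a, true))) + N (Sum.inr (m, (a, false)))) : ℕ) : ℤ) := by
      exact_mod_cast h
    push_cast at hz hsum
    linarith
  · intro h
    have hz : (2 : ℤ) * ((N (Sum.inl true) : ℤ) + ((∑ m : Fin 3, ∑ a : Fin 4, N (Sum.inr (m, (a, signTab r m a))) : ℕ) : ℤ)) =
        (N (Sum.inl true) : ℤ) + N (Sum.inl false) +
          ((∑ m : Fin 3, ∑ a : Fin 4, (N (Sum.inr (m, (a, true))) + N (Sum.inr (m, (a, false)))) : ℕ) : ℤ) := by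
      push_cast at hsum ⊢
      linarith
    exact_mod_cast hz

/-- **THE DEFECT LAW, linear-algebra core**: the twelve signed `A₄`-equations force `e = 0` and each `d_m` constant in `a`
(rank `10` in the `13` unknowns). [cite: Dodson1984, §3.3.2 Theorem] [cite: MoonenZarhin1995Duke, Thm. 2.4] -/
theorem defect₃_of_signed (e : ℤ) (d : Fin 3 → Fin 4 → ℤ)
    (h : ∀ r : Fin 12, e + ∑ m : Fin 3, ∑ a : Fin 4, (if signTab r m a then d m a else -d m a) = 0) :
    e = 0 ∧ ∀ (m : Fin 3) (a : Fin 4), d m a = d m 0 := by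
  have h0 := h 0; have h1 := h 1; have h2 := h 2; have h3 := h 3; have h4 := h 4; have h5 := h 5
  have h6 := h 6; have h7 := h 7; have h8 := h 8; have h9 := h 9; have h10 := h 10; have h11 := h 11
  simp [Fin.sum_univ_three, Fin.sum_univ_four, signTab] at h0 h1 h2 h3 h4 h5 h6 h7 h8 h9 h10 h11
  refine ⟨by omega, fun m a => ?_⟩
  fin_cases m <;> fin_cases a <;> simp <;> omega

variable {v}

/-- **THE DEFECT LAW of a balanced configuration**: `N(inl true) = N(inl false)` and, for each type `m`, ONE integer `t_m`
with `N(m,a,true) − N(m,a,false) = t_m` for all four `a`. [cite: GaoUllmo2025, Thm 3.1] [cite: Dodson1984, §3.3.2 Theorem] -/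
theorem exists_defect₃_of_modelBalanced₃ {T : Finset α} (hT : ModelBalanced₃ v T) :
    (T.filter fun x => v x = Sum.inl true).card = (T.filter fun x => v x = Sum.inl false).card ∧
      ∀ m : Fin 3, ∃ t : ℤ, ∀ a : Fin 4, ((T.filter fun x => v x = Sum.inr (m, (a, true))).card : ℤ) -
        (T.filter fun x => v x = Sum.inr (m, (a, false))).card = t := by
  have hs := fun r => (balanced₃_iff_signed r (fun y => (T.filter fun x => v x = y).card)).1 (by
    have h := hT r
    rw [card_filter_mem_eq_sum₃, card_eq_sum₃ v T] at h
    exact h)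
  obtain ⟨he, hd⟩ := defect₃_of_signed _
    (fun m a => (((T.filter fun x => v x = Sum.inr (m, (a, true))).card : ℕ) : ℤ) -
      (T.filter fun x => v x = Sum.inr (m, (a, false))).card) hs
  exact ⟨by omega, fun m => ⟨_, fun a => hd m a⟩⟩

end Summit.HodgeConjecture.CorCM.Census.OcticWeilOrbit
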